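import Literature.AlgebraicGeometry.Resolution.CobordantBlowupRegularCentre
import Mathlib.RingTheory.Kaehler.JacobiZariski
import Mathlib.RingTheory.Smooth.Kaehler
import Mathlib.RingTheory.Kaehler.Polynomial
import Mathlib.Algebra.MvPolynomial.PDeriv

/-!
# The `p`-th power slicing lemma (local algebra)

Crux `ProductDescent` (stmt-ResolutionOfSingularities-15231), line `birth`, stub
`stub_pthPowerSliceAlgebra`.

Let `S` be a regular local ring which is formally smooth over the polynomial ring
`P = 𝔽_p[X₁, …, X_s]`, and let `gᵢ ∈ S` with `fᵢ := Xᵢ·1 - gᵢᵖ ∈ 𝔪_S`. Then `S/(f₁, …, f_s)` is a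
regular local ring. Proof: by the Jacobi–Zariski sequence for `𝔽_p → P → S`
(`Algebra.H1Cotangent.exact_δ_mapBaseChange`) and `H₁(L_{S/P}) = 0`, the map
`S ⊗_P Ω_{P/𝔽_p} → Ω_{S/𝔽_p}` is injective; its cokernel `Ω_{S/P}` is projective, so it is split
injective and stays injective after `κ ⊗_S -` (`κ` the residue field). Since `Ω_{P/𝔽_p}` is free on
the `dXᵢ`, the `1 ⊗ dXᵢ` are linearly independent in `κ ⊗_S Ω_{S/𝔽_p}`. In characteristic `p`,
`d(gᵖ) = 0`, so `dfᵢ = dXᵢ`; the conormal map `𝔪/𝔪² → κ ⊗_S Ω_{S/𝔽_p}`, `f̄ ↦ 1 ⊗ df`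
(`KaehlerDifferential.kerCotangentToTensor`) then shows that the `f̄ᵢ ∈ 𝔪/𝔪²` are linearly
independent, and Matsumura's Thm. 14.2 (`isRegularLocalRing_quotient_span_range`) concludes.

All statements are folklore / Matsumura Thm. 14.2; no named fact is introduced.
-/

noncomputable section

set_option linter.dupNamespace false

open CategoryTheory CategoryTheory.Limits AlgebraicGeometry Literature.AlgebraicGeometry.Resolution
open IsLocalRing TensorProduct KaehlerDifferential

namespace Summit.ResolutionOfSingularities.ResolutionOfSingularities.Theorems.ProductDescent.Birth

universe u

section SplitInjective

variable {k P S : Type u} [CommRing k] [CommRing P] [CommRing S] [Algebra k P] [Algebra k S]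
  [Algebra P S] [IsScalarTower k P S]

/-- For `k → P → S` with `S` formally smooth over `P`, the map `S ⊗_P Ω_{P/k} → Ω_{S/k}` has a
retraction: it is injective by the Jacobi–Zariski sequence (`H₁(L_{S/P}) = 0`), and its cokernel
`Ω_{S/P}` is projective. [folklore] -/
theorem pthPowerSlice_exists_retraction_mapBaseChange [Algebra.FormallySmooth P S] :
    ∃ r : Ω[S⁄k] →ₗ[S] S ⊗[P] Ω[P⁄k],
      r ∘ₗ KaehlerDifferential.mapBaseChange k P S = LinearMap.id := by
  -- injectivity of `S ⊗ Ω[P/k] → Ω[S/k]`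
  have hinj : Function.Injective (KaehlerDifferential.mapBaseChange k P S) := by
    intro x y hxy
    have hex := Algebra.H1Cotangent.exact_δ_mapBaseChange k P S
    rw [← sub_eq_zero, ← map_sub] at hxy
    obtain ⟨z, hz⟩ := (hex (x - y)).mp hxy
    rw [Subsingleton.elim z 0, map_zero] at hz
    exact sub_eq_zero.mp hz.symm
  -- a section of `Ω[S/k] → Ω[S/P]`
  obtain ⟨sct, hsct⟩ := Module.projective_lifting_property (KaehlerDifferential.map k P S S)
    LinearMap.id (KaehlerDifferential.map_surjective k P S)
  have hsct' : ∀ w, KaehlerDifferential.map k P S S (sct w) = w := fun w =>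
    LinearMap.congr_fun hsct w
  -- the induced retraction of `mapBaseChange`
  have hrange : ∀ x : Ω[S⁄k], x - sct (KaehlerDifferential.map k P S S x) ∈
      LinearMap.range (KaehlerDifferential.mapBaseChange k P S) := by
    intro x
    apply ((KaehlerDifferential.exact_mapBaseChange_map k P S) _).mp
    rw [map_sub, hsct', sub_self]
  let e := LinearEquiv.ofInjective _ hinj
  let ψ : Ω[S⁄k] →ₗ[S] LinearMap.range (KaehlerDifferential.mapBaseChange k P S) :=
    LinearMap.codRestrict _ (LinearMap.id - sct ∘ₗ KaehlerDifferential.map k P S S) hrange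
  refine ⟨e.symm.toLinearMap ∘ₗ ψ, ?_⟩
  apply LinearMap.ext
  intro y
  change e.symm (ψ (KaehlerDifferential.mapBaseChange k P S y)) = y
  rw [LinearEquiv.symm_apply_eq]
  apply Subtype.ext
  change KaehlerDifferential.mapBaseChange k P S y -
      sct (KaehlerDifferential.map k P S S (KaehlerDifferential.mapBaseChange k P S y)) =
    KaehlerDifferential.mapBaseChange k P S y
  have h0 : KaehlerDifferential.map k P S S (KaehlerDifferential.mapBaseChange k P S y) = 0 :=
    ((KaehlerDifferential.exact_mapBaseChange_map k P S) _).mpr ⟨y, rfl⟩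
  rw [h0, map_zero, sub_zero]

/-- For `k → P → S` with `S` formally smooth over `P` and `Ω_{P/k}` free on `b`, the elements
`1 ⊗ d(bᵢ)` of `L ⊗_S Ω_{S/k}` are linearly independent over any `S`-algebra `L`: the split
injection `S ⊗_P Ω_{P/k} → Ω_{S/k}` stays injective after `L ⊗_S -`. [folklore] -/
theorem pthPowerSlice_linearIndependent_tmul [Algebra.FormallySmooth P S] {ι : Type*}
    (b : Module.Basis ι P Ω[P⁄k]) (L : Type u) [CommRing L] [Algebra S L] :
    LinearIndependent L fun i => (1 : L) ⊗ₜ[S] KaehlerDifferential.map k k P S (b i) := by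
  obtain ⟨r, hr⟩ := pthPowerSlice_exists_retraction_mapBaseChange (k := k) (P := P) (S := S)
  -- the base-changed map is (split) injective
  have hker : LinearMap.ker ((KaehlerDifferential.mapBaseChange k P S).baseChange L) = ⊥ := by
    refine LinearMap.ker_eq_bot_of_inverse (g := r.baseChange L) ?_
    rw [← LinearMap.baseChange_comp, hr, LinearMap.baseChange_id]
  -- a basis of `L ⊗[S] (S ⊗[P] Ω[P/k])`
  let bS : Module.Basis ι S (S ⊗[P] Ω[P⁄k]) := Algebra.TensorProduct.basis S b
  let bL : Module.Basis ι L (L ⊗[S] (S ⊗[P] Ω[P⁄k])) := Algebra.TensorProduct.basis L bS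
  have hfun : (fun i => (1 : L) ⊗ₜ[S] KaehlerDifferential.map k k P S (b i)) =
      (KaehlerDifferential.mapBaseChange k P S).baseChange L ∘ bL := by
    funext i
    simp only [Function.comp_apply, bL, bS, Algebra.TensorProduct.basis_apply,
      LinearMap.baseChange_tmul, KaehlerDifferential.mapBaseChange_tmul, one_smul]
  rw [hfun]
  exact bL.linearIndependent.map' _ hker

/-- For `k → P → S` with `S` local and formally smooth over `P`, `Ω_{P/k}` free on `b`, and
`fᵢ ∈ 𝔪_S` with `dfᵢ = d(bᵢ)` in `Ω_{S/k}`: the images of the `fᵢ` in `𝔪/𝔪²` are linearly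
independent over the residue field (apply the conormal map `𝔪/𝔪² → κ ⊗_S Ω_{S/k}`,
`f̄ ↦ 1 ⊗ df`). [folklore] -/
theorem pthPowerSlice_linearIndependent_toCotangent [IsLocalRing S] [Algebra.FormallySmooth P S]
    {ι : Type*} (b : Module.Basis ι P Ω[P⁄k]) (f : ι → S) (hf : ∀ i, f i ∈ maximalIdeal S)
    (hD : ∀ i, D k S (f i) = KaehlerDifferential.map k k P S (b i)) :
    LinearIndependent (ResidueField S) fun i => (maximalIdeal S).toCotangent ⟨f i, hf i⟩ := by
  let κ := ResidueField S
  have hsurj : Function.Surjective (algebraMap S κ) := residue_surjective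
  -- the ideal `J = ker (S → κ) = 𝔪`
  let J : Ideal S := RingHom.ker (algebraMap S κ)
  have hJ : J = maximalIdeal S := by
    change RingHom.ker (algebraMap S κ) = _
    rw [ResidueField.algebraMap_eq, ker_residue]
  have hle : maximalIdeal S ≤ J.comap (AlgHom.id S S) := fun x hx => by
    simpa [hJ] using hx
  -- the conormal map `𝔪/𝔪² → κ ⊗ Ω[S/k]`, `S`-linear then `κ`-linear
  let Φ : (maximalIdeal S).Cotangent →ₗ[S] κ ⊗[S] Ω[S⁄k] :=
    kerCotangentToTensor k S κ ∘ₗ Ideal.mapCotangent (maximalIdeal S) J (AlgHom.id S S) hle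
  have hΦ : ∀ i, Φ ((maximalIdeal S).toCotangent ⟨f i, hf i⟩) =
      (1 : κ) ⊗ₜ[S] KaehlerDifferential.map k k P S (b i) := by
    intro i
    change kerCotangentToTensor k S κ (Ideal.mapCotangent (maximalIdeal S) J (AlgHom.id S S) hle
      ((maximalIdeal S).toCotangent ⟨f i, hf i⟩)) = _
    rw [Ideal.mapCotangent_toCotangent, kerCotangentToTensor_toCotangent, ← hD i]
    rfl
  let Φκ : (maximalIdeal S).Cotangent →ₗ[κ] κ ⊗[S] Ω[S⁄k] := Φ.extendScalarsOfSurjective hsurj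
  refine LinearIndependent.of_comp Φκ ?_
  have hfun : (Φκ ∘ fun i => (maximalIdeal S).toCotangent ⟨f i, hf i⟩) =
      fun i => (1 : κ) ⊗ₜ[S] KaehlerDifferential.map k k P S (b i) := by
    funext i
    exact hΦ i
  rw [hfun]
  exact pthPowerSlice_linearIndependent_tmul b κ

end SplitInjective

/-- **The `p`-th power slicing lemma (local algebra).** If `S` is a regular local ring, formally
smooth over `𝔽_p[X₁,…,X_s]`, and `gᵢ ∈ S` with `Xᵢ - gᵢᵖ ∈ 𝔪_S`, then `S/(Xᵢ - gᵢᵖ)ᵢ` is a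
regular local ring: by Jacobi–Zariski for `𝔽_p → 𝔽_p[X] → S` the `dXᵢ` stay linearly
independent in `κ ⊗ Ω_{S/𝔽_p}`, `d(gᵖ) = 0`, so the `Xᵢ - gᵢᵖ` have independent images in
`𝔪/𝔪²` and Matsumura's Thm. 14.2 (`isRegularLocalRing_quotient_span_range`) applies.
[cite: Matsumura1987, Thm. 14.2] -/
theorem stub_pthPowerSliceAlgebra :
    ∀ (p : ℕ), p.Prime → ∀ (s : ℕ) (S : Type) [CommRing S] [IsRegularLocalRing S]
      [Algebra (MvPolynomial (Fin s) (ZMod p)) S]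
      [Algebra.FormallySmooth (MvPolynomial (Fin s) (ZMod p)) S] (g : Fin s → S),
      (∀ i, algebraMap (MvPolynomial (Fin s) (ZMod p)) S (MvPolynomial.X i) - g i ^ p ∈
          IsLocalRing.maximalIdeal S) →
      IsRegularLocalRing (S ⧸ Ideal.span (Set.range fun i =>
        algebraMap (MvPolynomial (Fin s) (ZMod p)) S (MvPolynomial.X i) - g i ^ p)) := by
  intro p hp s S _ _ _ _ g hg
  -- `S` as an `𝔽_p`-algebra through `𝔽_p[X] → S`
  letI : Algebra (ZMod p) S :=
    ((algebraMap (MvPolynomial (Fin s) (ZMod p)) S).comp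
      (algebraMap (ZMod p) (MvPolynomial (Fin s) (ZMod p)))).toAlgebra
  haveI : IsScalarTower (ZMod p) (MvPolynomial (Fin s) (ZMod p)) S :=
    IsScalarTower.of_algebraMap_eq fun _ => rfl
  have hpS : (p : S) = 0 := by
    rw [← map_natCast (algebraMap (ZMod p) S) p, ZMod.natCast_self, map_zero]
  refine isRegularLocalRing_quotient_span_range _ hg ?_
  refine pthPowerSlice_linearIndependent_toCotangent
    (KaehlerDifferential.mvPolynomialBasis (ZMod p) (Fin s)) _ hg fun i => ?_
  -- `d(Xᵢ - gᵢᵖ) = dXᵢ` in characteristic `p`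
  rw [KaehlerDifferential.mvPolynomialBasis_apply, KaehlerDifferential.map_D, map_sub,
    Derivation.leibniz_pow, ← Nat.cast_smul_eq_nsmul S p, hpS, zero_smul, sub_zero]

end Summit.ResolutionOfSingularities.ResolutionOfSingularities.Theorems.ProductDescent.Birth
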